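import Summits.MatrixMultiplication.MatrixMultiplication.Theorems.AbelianSTPPCensusShapeCertVQSearchE
import Summits.MatrixMultiplication.MatrixMultiplication.Theorems.AbelianSTPPCensusShapeCertVQFinal

/-!
# Abelian STPP census — from the route vocabulary to the checker `ShapeCertVQ.checkQE` (E3⁺ continuation budget)

Cell mm-stpp, rung F-M1; successor kernel item VQ-CERT (T_E beyond 337 under vQ := vP ∧ E3⁺) in support of the closed crux item
stmt-MatrixMultiplication-19191; seat mm-stpp-vp-p2 (gen 1).  The one-order bridge for the budgeted checker, verbatim after
`ShapeCertVQ.shapeExclusionVQ_of_checkQ` (`…ShapeCertVQFinal`) with `checkQE_sound` (`…ShapeCertVQSearchE`):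
**if `checkQE M = true` (`M ≤ 489`) then no shape list with at least two members satisfying `SieveAdmissibleVP M` and `E3pAdm M`
beats `5/2`.**  Kernel evaluations: `…ShapeCertVQEvalE*`; leaves: `…LeafTE…`.
-/

set_option linter.dupNamespace false -- `MatrixMultiplication.MatrixMultiplication` (summit = problem, D-0017)
set_option autoImplicit false

namespace Summit.MatrixMultiplication.MatrixMultiplication.Theorems.ShapeCertVQ

open ShapeCert ShapeCertVP STPPThreeRoomEnergy Finset

/-- **From the budgeted checker to the vQ shape exclusion at one order.**  If `checkQE M = true` (`M ≤ 489`), no shape list with at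
least two members satisfying the vP sieve system and E3⁺ (`E3pAdm`) beats `5/2` at order `M`. -/
theorem shapeExclusionVQ_of_checkQE {M : ℕ} (hM : M ≤ 489) (hc : checkQE M = true) :
    ∀ (N : ℕ) (a b c : Fin N → ℕ), 2 ≤ N → SieveAdmissibleVP M a b c → E3pAdm M a b c → ¬ Beats (5 / 2) M a b c := by
  intro N a b c hN hVP hE hB
  obtain ⟨hS, hG, -⟩ := hVP
  exact checkQE_sound hc hM (GM a b c)
    (fun x hx => by obtain ⟨i, rfl⟩ := (mem_GM a b c).mp hx; exact inUniv_shp a b c hN hS i)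
    (admM_GM a b c hN hS) (admG_GM a b c hS hG) (admE_GM a b c hE) (beats_gsumQ a b c hS hM hB)

end Summit.MatrixMultiplication.MatrixMultiplication.Theorems.ShapeCertVQ
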